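import Summits.AtomisticToContinuum.FouriersLaw.Theorems.HonestZwanzigNetworkReductionLimits
import Summits.AtomisticToContinuum.FouriersLaw.Theorems.HonestZwanzigGeneratorSiteEnergy
import Summits.AtomisticToContinuum.FouriersLaw.Theorems.HonestZwanzigParityStatics
import Summits.AtomisticToContinuum.FouriersLaw.Theorems.HonestZwanzigOrthogonalOhmRegressionIdentity

/-!
# HonestZwanzig / PositiveMemory — pairwise Kirchhoff flatness of the unprojected current covariance (line `Sketch`, Stub PL)

Support file for item `stmt-AtomisticToContinuum-12694` (`PositiveMemory` of route `HonestZwanzig`, sub-problem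
`FouriersLaw`), line `Sketch` v8+, registered stub `stub_pairLimit`: at fixed `N ≥ 2`, for ALL PAIRS of genuine bonds
`b, b'` (`b + 1 < N`, `b' + 1 < N`), `lap_s(j_b, j_{b'}) → ∫₀^∞corr(J,J)/(N−1)²` as `s ↓ 0`, given the row limit
`lap_s(j_{b'}, J) → ∫₀^∞corr(J,J)/(N−1)` (Stub R, landed as `…PositiveMemoryRowLimit`, taken here as a hypothesis).
So the zero-frequency covariance matrix of the bond currents under the FULL equilibrium dynamics is exactly flat
(rank one, `= T²G_N·𝟙𝟙ᵀ` by the Kundu–Dhar–Narayan identity): it carries no spatial information at all, and every bit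
of locality / homogeneity of the bond memory kernel `𝔎_N(s)_{bb'} = schur_s(j_b, j_{b'})` lives in the Feshbach
correction `a_bᵀG(s)⁻¹a_{b'}` (a positive semidefinite Gram matrix, Stub MG).

Proof. Fix `s > 0` and a genuine bond `b'`. For an interior site `y` (`1 ≤ y ≤ N − 2`) the first Kolmogorov
identity with `g = j_{b'}` (`FeshbachIdentities` (iii)) and parity `cov(e_y, j_{b'}) = 0` (`ParityStatics`) give
`lap_s(j_y, j_{b'}) − lap_s(j_{y−1}, j_{b'}) = lap_s((L e_y)∘Θ, j_{b'}) = s·lap_s(e_y, j_{b'})`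
(`pkg_Lr_lap`: no bath term at interior sites). Telescoping and summing over the genuine bonds
(`Σ_b lap_s(j_b, j_{b'}) = lap_s(J, j_{b'}) = lap_s(j_{b'}, J)`, time reversal) give
`(N−1)·lap_s(j_b, j_{b'}) = lap_s(j_{b'}, J) + s·E(s)` with `E(s)` an integer combination of the `lap_s(e_y, j_{b'})`,
bounded by `∫₀^∞|corr(e_y, j_{b'})|` uniformly in `s ≥ 0`; then the row limit.

Package lemmas `PairLimit.*`; `stub_pairLimit` is the registered stub (verbatim signature). No definitions, no named facts.
-/

noncomputable section

open MeasureTheory Finset Real Set Filter Topology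
open Literature.MathematicalPhysics.KineticTheory.HeatConduction
open Summit.AtomisticToContinuum.FouriersLaw.Theorems.HonestZwanzig.NetworkReduction

namespace Summit.AtomisticToContinuum.FouriersLaw.Theorems.HonestZwanzig.PositiveMemory

namespace PairLimit

section Package

variable {ω₂ lam β γ : ℝ} {N : ℕ} {T : ℝ}
  {Adm : (PhaseSpace N → ℝ) → Prop}
  {corr : (PhaseSpace N → ℝ) → (PhaseSpace N → ℝ) → ℝ → ℝ}
  {lap : ℝ → (PhaseSpace N → ℝ) → (PhaseSpace N → ℝ) → ℝ}
  {cov : (PhaseSpace N → ℝ) → (PhaseSpace N → ℝ) → ℝ}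
  {e : Fin N → PhaseSpace N → ℝ}
  (hAdm : ∀ f, Adm f ↔ (Continuous f ∧ ∃ A : ℝ, ∀ z,
    |f z| ≤ A * Real.exp ((pinnedChain ω₂ lam β γ).hamiltonian N z / (8 * T))))
  (hcorr : ∀ f g t, corr f g t =
    (∫ z, f z * (∫ y, g y ∂((pinnedChain ω₂ lam β γ).transitionKernel N T T t.toNNReal z))
      ∂(pinnedChain ω₂ lam β γ).gibbsMeasure N T) -
    (∫ z, f z ∂(pinnedChain ω₂ lam β γ).gibbsMeasure N T) *
      (∫ z, g z ∂(pinnedChain ω₂ lam β γ).gibbsMeasure N T))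
  (hlap : ∀ s f g, lap s f g = ∫ t in Set.Ioi (0 : ℝ), Real.exp (-(s * t)) * corr f g t)
  (hcov : ∀ f g, cov f g = (∫ z, f z * g z ∂(pinnedChain ω₂ lam β γ).gibbsMeasure N T) -
    (∫ z, f z ∂(pinnedChain ω₂ lam β γ).gibbsMeasure N T) *
      (∫ z, g z ∂(pinnedChain ω₂ lam β γ).gibbsMeasure N T))
  (he : ∀ x z, e x z = z.2 x ^ 2 / 2 + (pinnedChain ω₂ lam β γ).U (z.1 x) +
    ∑ j : Fin N, ((if j.val = x.val + 1 then (pinnedChain ω₂ lam β γ).V (z.1 j - z.1 x) / 2 else 0) +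
      (if x.val = j.val + 1 then (pinnedChain ω₂ lam β γ).V (z.1 x - z.1 j) / 2 else 0)))
  (hFI : ∀ f g : PhaseSpace N → ℝ, Adm f → Adm g →
    Integrable f ((pinnedChain ω₂ lam β γ).gibbsMeasure N T) ∧
    (∀ t : ℝ, 0 ≤ t → Integrable (fun z => f z *
      (∫ y, g y ∂((pinnedChain ω₂ lam β γ).transitionKernel N T T t.toNNReal z)))
      ((pinnedChain ω₂ lam β γ).gibbsMeasure N T)) ∧
    IntegrableOn (corr f g) (Set.Ioi 0) ∧
    (∀ t : ℝ, 0 ≤ t → corr f g t = corr (fun z => g (z.1, -z.2)) (fun z => f (z.1, -z.2)) t) ∧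
    (∀ s : ℝ, 0 < s → ∀ x : Fin N,
      s * lap s (e x) g - cov (e x) g =
        lap s (fun z => (pinnedChain ω₂ lam β γ).generator N T T (e x) (z.1, -z.2)) g ∧
      s * lap s f (e x) - cov f (e x) = lap s f ((pinnedChain ω₂ lam β γ).generator N T T (e x))))
  (hGSE : ∀ (x : Fin N) (z : PhaseSpace N), (pinnedChain ω₂ lam β γ).generator N T T (e x) z =
    (∑ b : Fin N, ((if x.val = b.val + 1 then (pinnedChain ω₂ lam β γ).bondCurrent N b z else 0) -
      (if b = x then (pinnedChain ω₂ lam β γ).bondCurrent N b z else 0))) +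
    (if x.val = 0 then (pinnedChain ω₂ lam β γ).γ * (T - z.2 x ^ 2) else 0) +
    (if x.val = N - 1 then (pinnedChain ω₂ lam β γ).γ * (T - z.2 x ^ 2) else 0))
  (hPS1 : ∀ x b : Fin N, ∫ z, e x z * (pinnedChain ω₂ lam β γ).bondCurrent N b z
    ∂(pinnedChain ω₂ lam β γ).gibbsMeasure N T = 0)
  (hω : 0 < ω₂) (hl : 0 ≤ lam) (hβ : 0 ≤ β) (hγ : 0 ≤ γ) (hT : 0 < T)

include hAdm hcorr hlap hFI hω hl hβ hT in
/-- Time reversal between the total current and one bond current (both odd in `p`):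
`lap_s(J, j_{b'}) = lap_s(j_{b'}, J)`. -/
theorem lap_J_bond_rev (s : ℝ) (b' : Fin N) :
    lap s (fun z => ∑ i : Fin N, (pinnedChain ω₂ lam β γ).bondCurrent N i z)
        ((pinnedChain ω₂ lam β γ).bondCurrent N b') =
      lap s ((pinnedChain ω₂ lam β γ).bondCurrent N b')
        (fun z => ∑ i : Fin N, (pinnedChain ω₂ lam β γ).bondCurrent N i z) := by
  rw [lap_rev hlap hFI (adm_totalCurrent Adm hAdm hω hl hβ hT) (adm_bondCurrent Adm hAdm hω hl hβ hT b') s]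
  have h1 : (fun z : PhaseSpace N => ∑ i : Fin N, (pinnedChain ω₂ lam β γ).bondCurrent N i (z.1, -z.2)) =
      fun z => (-1) * ∑ i : Fin N, (pinnedChain ω₂ lam β γ).bondCurrent N i z := by
    funext z
    rw [neg_one_mul, ← Finset.sum_neg_distrib]
    exact Finset.sum_congr rfl fun i _ => OscillatorChain.bondCurrent_neg_momentum _ N i z
  have h2 : (fun z : PhaseSpace N => (pinnedChain ω₂ lam β γ).bondCurrent N b' (z.1, -z.2)) =
      fun z => (-1) * (pinnedChain ω₂ lam β γ).bondCurrent N b' z := by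
    funext z
    rw [neg_one_mul]
    exact OscillatorChain.bondCurrent_neg_momentum _ N b' z
  rw [h1, h2, lap_const_mul_left hcorr hlap, lap_const_mul_right hcorr hlap]
  ring

include hAdm hcorr hlap hcov he hFI hGSE hPS1 hω hl hβ hγ hT in
/-- **The interior step against a bond current.** For an interior site `y` (`1 ≤ y`, `y + 1 < N`), `s > 0` and
any bond `b'`: `lap_s(j_y, j_{b'}) − lap_s(j_{y−1}, j_{b'}) = s·lap_s(e_y, j_{b'})`. -/
theorem pair_step {s : ℝ} (hs : 0 < s) (y : Fin N) (hy0 : 0 < y.val) (hy1 : y.val + 1 < N)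
    (y' : Fin N) (hy' : y.val = y'.val + 1) (b' : Fin N) :
    lap s ((pinnedChain ω₂ lam β γ).bondCurrent N y) ((pinnedChain ω₂ lam β γ).bondCurrent N b') -
      lap s ((pinnedChain ω₂ lam β γ).bondCurrent N y') ((pinnedChain ω₂ lam β γ).bondCurrent N b') =
      s * lap s (e y) ((pinnedChain ω₂ lam β γ).bondCurrent N b') := by
  have hg : Adm ((pinnedChain ω₂ lam β γ).bondCurrent N b') := adm_bondCurrent Adm hAdm hω hl hβ hT b'
  have hey : Adm (e y) := adm_e Adm hAdm e he hω hl hβ hT y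
  have hLr := pkg_Lr_lap hAdm hcorr hlap hFI hGSE hω hl hβ hγ hT hs.le y hg
  have hK := ((hFI (e y) _ hey hg).2.2.2.2 s hs y).1
  have hcov0 : cov (e y) ((pinnedChain ω₂ lam β γ).bondCurrent N b') = 0 := by
    rw [cov_comm hcov]
    exact OrthogonalOhmLine.RegressionIdentity.cov_j_e hcov hPS1 b' y
  rw [hcov0, sub_zero, hLr] at hK
  have hne0 : y.val ≠ 0 := by omega
  have hneN : y.val ≠ N - 1 := by omega
  rw [if_neg hne0, if_neg hneN, add_zero, mul_zero, neg_zero, zero_mul, add_zero] at hK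
  have hsum1 : ∑ b : Fin N, ((if b = y then (1 : ℝ) else 0) - (if y.val = b.val + 1 then 1 else 0)) *
      lap s ((pinnedChain ω₂ lam β γ).bondCurrent N b) ((pinnedChain ω₂ lam β γ).bondCurrent N b') =
      lap s ((pinnedChain ω₂ lam β γ).bondCurrent N y) ((pinnedChain ω₂ lam β γ).bondCurrent N b') -
      lap s ((pinnedChain ω₂ lam β γ).bondCurrent N y') ((pinnedChain ω₂ lam β γ).bondCurrent N b') := by
    simp only [sub_mul, Finset.sum_sub_distrib, ite_mul, one_mul, zero_mul]
    rw [Finset.sum_ite_eq' Finset.univ y, if_pos (Finset.mem_univ _)]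
    congr 1
    rw [Finset.sum_eq_single y']
    · rw [if_pos hy']
    · intro b _ hb
      rw [if_neg]
      intro h
      apply hb
      apply Fin.ext
      omega
    · intro h
      exact absurd (Finset.mem_univ _) h
  rw [hsum1] at hK
  exact hK.symm

/-- **Telescoping** (elementary): if `U m − U (m−1) = c·A m` for `1 ≤ m`, `m + 1 < N`, then
`U n = U 0 + c·Σ_{m<n} A(m+1)` for every `n` with `n + 1 < N`. -/
theorem telescope (U A : ℕ → ℝ) (c : ℝ)
    (hstep : ∀ m : ℕ, 0 < m → m + 1 < N → U m - U (m - 1) = c * A m) :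
    ∀ n : ℕ, n + 1 < N → U n = U 0 + c * ∑ m ∈ Finset.range n, A (m + 1) := by
  intro n
  induction n with
  | zero =>
    intro _
    simp
  | succ n ih =>
    intro hn
    have h := hstep (n + 1) (by omega) hn
    rw [Nat.add_sub_cancel] at h
    rw [Finset.sum_range_succ, mul_add]
    have := ih (by omega)
    linarith

include hAdm hcorr hlap hcov he hFI hGSE hPS1 hω hl hβ hγ hT in
/-- **The fixed-`s` pairwise identity.** For `N ≥ 2`, `s > 0`, a bond `b'` and every genuine bond index `n`
(`n + 1 < N`): `(N−1)·lap_s(j_n, j_{b'}) = lap_s(j_{b'}, J) + s·E_n(s)` with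
`E_n(s) = (N−1)·Σ_{i<n} A(i+1) − Σ_{m<N−1} Σ_{i<m} A(i+1)`, `A(m) = lap_s(e_m, j_{b'})`. -/
theorem pair_identity (hN : 2 ≤ N) {s : ℝ} (hs : 0 < s) (b' : Fin N)
    (U A : ℕ → ℝ)
    (hU : ∀ (m : ℕ) (hm : m < N), U m = lap s ((pinnedChain ω₂ lam β γ).bondCurrent N ⟨m, hm⟩)
      ((pinnedChain ω₂ lam β γ).bondCurrent N b'))
    (hA : ∀ (m : ℕ) (hm : m < N), A m = lap s (e ⟨m, hm⟩) ((pinnedChain ω₂ lam β γ).bondCurrent N b'))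
    (n : ℕ) (hn : n + 1 < N) :
    ((N : ℝ) - 1) * U n =
      lap s ((pinnedChain ω₂ lam β γ).bondCurrent N b')
          (fun z => ∑ i : Fin N, (pinnedChain ω₂ lam β γ).bondCurrent N i z) +
        s * (((N : ℝ) - 1) * ∑ i ∈ Finset.range n, A (i + 1) -
          ∑ m ∈ Finset.range (N - 1), ∑ i ∈ Finset.range m, A (i + 1)) := by
  have hg : Adm ((pinnedChain ω₂ lam β γ).bondCurrent N b') := adm_bondCurrent Adm hAdm hω hl hβ hT b'
  -- the step relation in `ℕ`-indexed form
  have hstep : ∀ m : ℕ, 0 < m → m + 1 < N → U m - U (m - 1) = s * A m := by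
    intro m hm0 hm1
    rw [hU m (by omega), hU (m - 1) (by omega), hA m (by omega)]
    exact pair_step hAdm hcorr hlap hcov he hFI hGSE hPS1 hω hl hβ hγ hT hs ⟨m, by omega⟩ hm0 hm1
      ⟨m - 1, by omega⟩ (by simp only; omega) b'
  have htel := telescope U A s hstep
  -- `lap_s(J, j_{b'}) = Σ_{m < N} U m = Σ_{m < N-1} U m`
  have hJJ : lap s ((pinnedChain ω₂ lam β γ).bondCurrent N b')
      (fun z => ∑ i : Fin N, (pinnedChain ω₂ lam β γ).bondCurrent N i z) =
      ∑ m ∈ Finset.range (N - 1), U m := by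
    rw [← lap_J_bond_rev hAdm hcorr hlap hFI hω hl hβ hT s b',
      pkg_J_lap hAdm hcorr hlap hFI hω hl hβ hT hs.le hg]
    have h1 : ∑ b : Fin N, lap s ((pinnedChain ω₂ lam β γ).bondCurrent N b)
        ((pinnedChain ω₂ lam β γ).bondCurrent N b') = ∑ m ∈ Finset.range N, U m := by
      rw [← Fin.sum_univ_eq_sum_range]
      exact Finset.sum_congr rfl fun b _ => (hU b.val b.isLt).symm
    rw [h1]
    obtain ⟨M, rfl⟩ : ∃ M, N = M + 1 := ⟨N - 1, by omega⟩
    rw [Finset.sum_range_succ, Nat.add_sub_cancel]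
    have hlast : U M = 0 := by
      rw [hU M (by omega)]
      exact pkg_j_last hcorr hlap s ⟨M, by omega⟩ (by simp) _
    rw [hlast, add_zero]
  have hsumU : ∑ m ∈ Finset.range (N - 1), U m =
      ((N : ℝ) - 1) * U 0 + s * ∑ m ∈ Finset.range (N - 1), ∑ i ∈ Finset.range m, A (i + 1) := by
    rw [Finset.mul_sum, Finset.sum_congr rfl fun m hm => htel m (by
      have := Finset.mem_range.mp hm; omega), Finset.sum_add_distrib, Finset.sum_const, Finset.card_range,
      nsmul_eq_mul]
    have hc : ((N - 1 : ℕ) : ℝ) = (N : ℝ) - 1 := by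
      rw [Nat.cast_sub (by omega)]
      simp
    rw [hc]
  have hUn := htel n hn
  rw [hJJ, hsumU, hUn]
  ring

include hAdm hcorr hlap hcov he hFI hGSE hPS1 hω hl hβ hγ hT in
/-- **Pairwise Kirchhoff flatness in the limit `s ↓ 0`** for the canonical gadgets: if the row response
`lap_s(j_{b'}, J)` tends to `L`, then `lap_s(j_b, j_{b'}) → L/(N−1)` for every genuine bond `b`. -/
theorem tendsto_lap_pair (hN : 2 ≤ N) (b b' : Fin N) (hb : b.val + 1 < N) {L : ℝ}
    (hrow : Tendsto (fun s => lap s ((pinnedChain ω₂ lam β γ).bondCurrent N b')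
        (fun z => ∑ i : Fin N, (pinnedChain ω₂ lam β γ).bondCurrent N i z))
      (nhdsWithin (0 : ℝ) (Set.Ioi 0)) (nhds L)) :
    Tendsto (fun s => lap s ((pinnedChain ω₂ lam β γ).bondCurrent N b) ((pinnedChain ω₂ lam β γ).bondCurrent N b'))
      (nhdsWithin (0 : ℝ) (Set.Ioi 0)) (nhds (L / ((N : ℝ) - 1))) := by
  set J : PhaseSpace N → ℝ := fun z => ∑ i : Fin N, (pinnedChain ω₂ lam β γ).bondCurrent N i z with hJdef
  set jb' : PhaseSpace N → ℝ := (pinnedChain ω₂ lam β γ).bondCurrent N b' with hjb'def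
  have hg : Adm jb' := adm_bondCurrent Adm hAdm hω hl hβ hT b'
  have hex : ∀ x, Adm (e x) := fun x => adm_e Adm hAdm e he hω hl hβ hT x
  have hN1 : (0 : ℝ) < (N : ℝ) - 1 := by
    have : (2 : ℝ) ≤ N := by exact_mod_cast hN
    linarith
  -- bookkeeping functions
  set U : ℝ → ℕ → ℝ := fun s m => if hm : m < N then
    lap s ((pinnedChain ω₂ lam β γ).bondCurrent N ⟨m, hm⟩) jb' else 0 with hUdef
  set A : ℝ → ℕ → ℝ := fun s m => if hm : m < N then lap s (e ⟨m, hm⟩) jb' else 0 with hAdef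
  have hU : ∀ s (m : ℕ) (hm : m < N), U s m = lap s ((pinnedChain ω₂ lam β γ).bondCurrent N ⟨m, hm⟩) jb' := by
    intro s m hm
    simp only [hUdef, dif_pos hm]
  have hA : ∀ s (m : ℕ) (hm : m < N), A s m = lap s (e ⟨m, hm⟩) jb' := by
    intro s m hm
    simp only [hAdef, dif_pos hm]
  set E : ℝ → ℝ := fun s => ((N : ℝ) - 1) * ∑ i ∈ Finset.range b.val, A s (i + 1) -
    ∑ m ∈ Finset.range (N - 1), ∑ i ∈ Finset.range m, A s (i + 1) with hEdef
  -- uniform bound on `A s m`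
  set B : ℝ := ∑ y : Fin N, ∫ t in Set.Ioi (0 : ℝ), |corr (e y) jb' t| with hBdef
  have hB0 : 0 ≤ B := Finset.sum_nonneg fun y _ => integral_nonneg fun t => abs_nonneg _
  -- `|lap_s(e_y, j_{b'})| ≤ ∫₀^∞|corr(e_y, j_{b'})|` for `s ≥ 0` (`0 < e^{-st} ≤ 1`)
  have habs : ∀ s, 0 ≤ s → ∀ y : Fin N, |lap s (e y) jb'| ≤ ∫ t in Set.Ioi (0 : ℝ), |corr (e y) jb' t| := by
    intro s hs y
    have hI : IntegrableOn (corr (e y) jb') (Set.Ioi 0) := (hFI (e y) jb' (hex y) hg).2.2.1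
    rw [hlap, ← Real.norm_eq_abs]
    refine norm_integral_le_of_norm_le hI.abs ?_
    filter_upwards [ae_restrict_mem measurableSet_Ioi] with t ht
    rw [norm_mul, Real.norm_eq_abs, Real.norm_eq_abs, abs_of_pos (Real.exp_pos _)]
    have h1 : Real.exp (-(s * t)) ≤ 1 := by
      rw [← Real.exp_zero]
      exact Real.exp_le_exp.mpr (by nlinarith [mul_nonneg hs (le_of_lt (show (0 : ℝ) < t from ht))])
    calc Real.exp (-(s * t)) * |corr (e y) jb' t| ≤ 1 * |corr (e y) jb' t| :=
        mul_le_mul_of_nonneg_right h1 (abs_nonneg _)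
      _ = |corr (e y) jb' t| := one_mul _
  have hAB : ∀ s, 0 ≤ s → ∀ m, |A s m| ≤ B := by
    intro s hs m
    by_cases hm : m < N
    · rw [hA s m hm]
      calc |lap s (e ⟨m, hm⟩) jb'| ≤ ∫ t in Set.Ioi (0 : ℝ), |corr (e ⟨m, hm⟩) jb' t| := habs s hs _
        _ ≤ B := by
            rw [hBdef]
            exact Finset.single_le_sum (f := fun y => ∫ t in Set.Ioi (0 : ℝ), |corr (e y) jb' t|)
              (fun y _ => integral_nonneg fun t => abs_nonneg _) (Finset.mem_univ (⟨m, hm⟩ : Fin N))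
    · simp only [hAdef, dif_neg hm, abs_zero]
      exact hB0
  have hEB : ∀ s, 0 ≤ s → |E s| ≤ ((N : ℝ) - 1) * (N : ℝ) * B + (N : ℝ) * (N : ℝ) * B := by
    intro s hs
    have h1 : |∑ m ∈ Finset.range (N - 1), ∑ i ∈ Finset.range m, A s (i + 1)| ≤ (N : ℝ) * (N : ℝ) * B := by
      calc |∑ m ∈ Finset.range (N - 1), ∑ i ∈ Finset.range m, A s (i + 1)|
          ≤ ∑ m ∈ Finset.range (N - 1), |∑ i ∈ Finset.range m, A s (i + 1)| := Finset.abs_sum_le_sum_abs _ _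
        _ ≤ ∑ m ∈ Finset.range (N - 1), ((N : ℝ) * B) := by
            refine Finset.sum_le_sum fun m hm => ?_
            have hmN : m < N := by have := Finset.mem_range.mp hm; omega
            calc |∑ i ∈ Finset.range m, A s (i + 1)| ≤ ∑ i ∈ Finset.range m, |A s (i + 1)| :=
                  Finset.abs_sum_le_sum_abs _ _
              _ ≤ ∑ i ∈ Finset.range m, B := Finset.sum_le_sum fun i _ => hAB s hs _
              _ = (m : ℝ) * B := by rw [Finset.sum_const, Finset.card_range, nsmul_eq_mul]
              _ ≤ (N : ℝ) * B := by
                  have : (m : ℝ) ≤ N := by exact_mod_cast hmN.le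
                  exact mul_le_mul_of_nonneg_right this hB0
        _ = ((N - 1 : ℕ) : ℝ) * ((N : ℝ) * B) := by rw [Finset.sum_const, Finset.card_range, nsmul_eq_mul]
        _ ≤ (N : ℝ) * ((N : ℝ) * B) := by
            have : ((N - 1 : ℕ) : ℝ) ≤ N := by exact_mod_cast Nat.sub_le N 1
            exact mul_le_mul_of_nonneg_right this (by positivity)
        _ = (N : ℝ) * (N : ℝ) * B := by ring
    have h2 : |((N : ℝ) - 1) * ∑ i ∈ Finset.range b.val, A s (i + 1)| ≤ ((N : ℝ) - 1) * (N : ℝ) * B := by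
      rw [abs_mul, abs_of_pos hN1, mul_assoc]
      refine mul_le_mul_of_nonneg_left ?_ hN1.le
      calc |∑ i ∈ Finset.range b.val, A s (i + 1)| ≤ ∑ i ∈ Finset.range b.val, |A s (i + 1)| :=
            Finset.abs_sum_le_sum_abs _ _
        _ ≤ ∑ i ∈ Finset.range b.val, B := Finset.sum_le_sum fun i _ => hAB s hs _
        _ = (b.val : ℝ) * B := by rw [Finset.sum_const, Finset.card_range, nsmul_eq_mul]
        _ ≤ (N : ℝ) * B := by
            have : (b.val : ℝ) ≤ N := by exact_mod_cast b.isLt.le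
            exact mul_le_mul_of_nonneg_right this hB0
    calc |E s| ≤ |((N : ℝ) - 1) * ∑ i ∈ Finset.range b.val, A s (i + 1)| +
          |∑ m ∈ Finset.range (N - 1), ∑ i ∈ Finset.range m, A s (i + 1)| := abs_sub _ _
      _ ≤ _ := add_le_add h2 h1
  -- the fixed-`s` identity
  have hid : ∀ s, 0 < s → lap s ((pinnedChain ω₂ lam β γ).bondCurrent N b) jb' =
      lap s jb' J / ((N : ℝ) - 1) + s * E s / ((N : ℝ) - 1) := by
    intro s hs
    have h := pair_identity hAdm hcorr hlap hcov he hFI hGSE hPS1 hω hl hβ hγ hT hN hs b' (U s) (A s) (hU s) (hA s)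
      b.val hb
    rw [hU s b.val b.isLt] at h
    have hb'' : (⟨b.val, b.isLt⟩ : Fin N) = b := Fin.ext rfl
    rw [hb'', ← hJdef] at h
    have hE : E s = ((N : ℝ) - 1) * ∑ i ∈ Finset.range b.val, A s (i + 1) -
        ∑ m ∈ Finset.range (N - 1), ∑ i ∈ Finset.range m, A s (i + 1) := rfl
    rw [← hE] at h
    field_simp
    linarith [h]
  -- pass to the limit
  have hmain : Tendsto (fun s => lap s jb' J / ((N : ℝ) - 1) + s * E s / ((N : ℝ) - 1))
      (nhdsWithin (0 : ℝ) (Set.Ioi 0)) (nhds (L / ((N : ℝ) - 1) + 0)) := by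
    refine (hrow.div_const _).add ?_
    set M : ℝ := ((N : ℝ) - 1) * (N : ℝ) * B + (N : ℝ) * (N : ℝ) * B with hMdef
    have hsmall : Tendsto (fun s : ℝ => |s| * (M / ((N : ℝ) - 1))) (nhdsWithin (0 : ℝ) (Set.Ioi 0)) (nhds 0) := by
      have hc : Continuous fun s : ℝ => |s| * (M / ((N : ℝ) - 1)) := by fun_prop
      have := (hc.tendsto 0).mono_left (nhdsWithin_le_nhds (s := Set.Ioi (0 : ℝ)))
      simpa using this
    refine squeeze_zero_norm' ?_ hsmall
    filter_upwards [self_mem_nhdsWithin] with s hs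
    have hs0 : 0 < s := hs
    rw [Real.norm_eq_abs, abs_div, abs_mul, abs_of_pos hN1]
    rw [div_le_iff₀ hN1]
    have : |s| * (M / ((N : ℝ) - 1)) * ((N : ℝ) - 1) = |s| * M := by
      field_simp
    rw [this]
    exact mul_le_mul_of_nonneg_left (hEB s hs0.le) (abs_nonneg _)
  rw [add_zero] at hmain
  refine hmain.congr' ?_
  filter_upwards [self_mem_nhdsWithin] with s hs
  exact (hid s hs).symm

end Package

end PairLimit

/-- **Stub PL — pairwise Kirchhoff flatness** (registered; fixed `N`): given the row limit (Stub R), for all genuine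
bonds `b, b'`, `lap_s(j_b, j_{b'}) → ∫₀^∞corr(J,J)/(N−1)²` as `s ↓ 0`. The first Kolmogorov identity with `g = j_{b'}` and
parity `cov(e_y, j_{b'}) = 0` give `lap_s(j_y, j_{b'}) − lap_s(j_{y−1}, j_{b'}) = s·lap_s(e_y, j_{b'})` for interior `y`;
telescoping, `Σ_b lap_s(j_b, j_{b'}) = lap_s(J, j_{b'}) = lap_s(j_{b'}, J)` (time reversal) and Stub R. -/
theorem stub_pairLimit :
    Summit.AtomisticToContinuum.FouriersLaw.Theses.HonestZwanzig.FeshbachIdentities →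
    (∀ ω₂ lam β γ : ℝ, 0 < ω₂ → 0 < lam → 0 < β → 0 < γ → ∀ T : ℝ, 0 < T → ∀ N : ℕ, 2 ≤ N →
    let P := Literature.MathematicalPhysics.KineticTheory.HeatConduction.pinnedChain ω₂ lam β γ;
    let X := Literature.MathematicalPhysics.KineticTheory.HeatConduction.PhaseSpace N;
    let μ : MeasureTheory.Measure X := P.gibbsMeasure N T;
    let corr : (X → ℝ) → (X → ℝ) → ℝ → ℝ := fun f g t =>
      (∫ z, f z * (∫ y, g y ∂(P.transitionKernel N T T t.toNNReal z)) ∂μ) - (∫ z, f z ∂μ) * (∫ z, g z ∂μ);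
    let lap : ℝ → (X → ℝ) → (X → ℝ) → ℝ := fun s f g =>
      ∫ t in Set.Ioi (0 : ℝ), Real.exp (-(s * t)) * corr f g t;
    let J : X → ℝ := fun z => ∑ i : Fin N, P.bondCurrent N i z;
    ∀ b : Fin N, b.val + 1 < N →
      Filter.Tendsto (fun s => lap s (P.bondCurrent N b) J) (nhdsWithin (0 : ℝ) (Set.Ioi 0))
        (nhds ((∫ t in Set.Ioi (0 : ℝ), corr J J t) / ((N : ℝ) - 1)))) →
    ∀ ω₂ lam β γ : ℝ, 0 < ω₂ → 0 < lam → 0 < β → 0 < γ → ∀ T : ℝ, 0 < T → ∀ N : ℕ, 2 ≤ N →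
    let P := Literature.MathematicalPhysics.KineticTheory.HeatConduction.pinnedChain ω₂ lam β γ;
    let X := Literature.MathematicalPhysics.KineticTheory.HeatConduction.PhaseSpace N;
    let μ : MeasureTheory.Measure X := P.gibbsMeasure N T;
    let corr : (X → ℝ) → (X → ℝ) → ℝ → ℝ := fun f g t =>
      (∫ z, f z * (∫ y, g y ∂(P.transitionKernel N T T t.toNNReal z)) ∂μ) - (∫ z, f z ∂μ) * (∫ z, g z ∂μ);
    let lap : ℝ → (X → ℝ) → (X → ℝ) → ℝ := fun s f g =>
      ∫ t in Set.Ioi (0 : ℝ), Real.exp (-(s * t)) * corr f g t;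
    let J : X → ℝ := fun z => ∑ i : Fin N, P.bondCurrent N i z;
    ∀ b b' : Fin N, b.val + 1 < N → b'.val + 1 < N →
      Filter.Tendsto (fun s => lap s (P.bondCurrent N b) (P.bondCurrent N b')) (nhdsWithin (0 : ℝ) (Set.Ioi 0))
        (nhds ((∫ t in Set.Ioi (0 : ℝ), corr J J t) / ((N : ℝ) - 1) ^ 2)) := by
  intro hFI hRow ω₂ lam β γ hω hl hβ hγ T hT N hN
  obtain ⟨-, hFI2, -, -⟩ := hFI ω₂ lam β γ hω hl hβ hγ T hT N hN
  intro P X μ corr lap J b b' hb hb'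
  have hrow := hRow ω₂ lam β γ hω hl hβ hγ T hT N hN b' hb'
  have h := PairLimit.tendsto_lap_pair (ω₂ := ω₂) (lam := lam) (β := β) (γ := γ) (N := N) (T := T)
    (cov := fun f g => (∫ z, f z * g z ∂μ) - (∫ z, f z ∂μ) * (∫ z, g z ∂μ))
    (e := fun x z => z.2 x ^ 2 / 2 + P.U (z.1 x) +
      ∑ j : Fin N, ((if j.val = x.val + 1 then P.V (z.1 j - z.1 x) / 2 else 0) +
        (if x.val = j.val + 1 then P.V (z.1 x - z.1 j) / 2 else 0)))
    (fun f => Iff.rfl) (fun f g t => rfl) (fun s f g => rfl) (fun f g => rfl) (fun x z => rfl) hFI2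
    (fun x z => generatorSiteEnergy_proof ω₂ lam β γ N hN T T x z)
    (fun x c => ((parityStatics_proof ω₂ lam β γ hω hl hβ hγ T hT N hN) x).1 c)
    hω hl.le hβ.le hγ.le hT hN b b' hb hrow
  have heq : (∫ t in Set.Ioi (0 : ℝ), corr J J t) / ((N : ℝ) - 1) / ((N : ℝ) - 1) =
      (∫ t in Set.Ioi (0 : ℝ), corr J J t) / ((N : ℝ) - 1) ^ 2 := by
    rw [div_div, ← pow_two]
  rw [heq] at h
  exact h

end Summit.AtomisticToContinuum.FouriersLaw.Theorems.HonestZwanzig.PositiveMemory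

end
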